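import Mathlib
import Summits.Ventures.PercRepro.TriangleCapCapGenMain

/-!
# PercRepro — EVERY ROW `r = a + j`: THE ARITHMETIC OF THE DELETION READS FOR A GENERAL `j` (p3, gen 48; part 202d)

A vertex `z` of degree `d ≤ a − 1` deleted onto `(k − 1, a, d + j)` against the `(j + 1)`-broom target
`(a + j)(k − 1 − (a + j)) + (2 (k − a − 3) + 2j (a − 2))` (`a ≥ j + 5`, `k ≥ 3a + j`):
* `D − z` not `a`-bipartite with the gap of its cell (`rowJ_del_B2`: the `B2` regime `d + j ≤ a − 3`, slack
  `≥ 4w + 4c + 8j + 8`; `rowJ_del_T`: `d + j = a − 2`, slack `2 (a − j − 5) + 4`; `rowJ_del_B`: `d + j = a − 1`, EXACT;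
  `rowJ_del_up`: `d + j = a + j′`, `j′ ≤ j − 1`, with the `(j′ + 1)`-broom gap of the smaller row, slack
  `2 (j − j′ − 1)(j′ + 1)` — EXACT at `j′ = j − 1`), the neighbours of `z` at `≤ k − a − 2`;
* the crude mixed read at `d = 2` (`rowJ_mixed_two`: one off-side neighbour at `≤ a`, the other at `≤ k − a − 2`);
* the VERTEX-BOUND mixed reads at `d ≥ 3` (the missing graph of the `a`-bipartite `D − z` has `s = d + j` pairs, `x`
  of them at an off-side neighbour `w₀` of `z`, `x ≥ t − 1`; by the concavity of `(s − x)(x − 1)` only the endpoints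
  `x = t − 1` and `x = min (s, a)` matter): `rowJ_one_lo` / `rowJ_one_hi_s` / `rowJ_one_hi_a` for a single off-side
  neighbour (`t = d − 1`, the in-side neighbours at `≤ k − a − 2`) and `rowJ_two_lo` / `rowJ_two_hi_s` / `rowJ_two_hi_a`
  for `s₀ ≥ 2` off-side neighbours (the in-side neighbours at `≤ k − a − s₀`, the other off-side ones at `≤ a + 1 − t`).
Every slack is an explicit polynomial with non-negative value on the range (mining/p3/g48 rowjslack.py). Axioms:
standard.
-/

namespace PercRepro

namespace TriangleCap

namespace C047

/-- `d + j + 3 ≤ a`: `D − z` on a `B2` cell `(k − 1, a, d + j)`. -/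
theorem rowJ_del_B2 (a j d k m' S' T : ℕ) (hs : d + j + 3 ≤ a) (hk : 3 * a + j ≤ k)
    (hmd : m' + d + (a + j) = a * (k - a))
    (hgap : S' + (d + j) * (k - 1 - 1 - (d + j)) + 2 * (k - 1 - 2 * a - 1) * (a - (d + j)) ≤ m' * (k - 1))
    (hT : T ≤ d * (k - a - 2)) :
    S' + 2 * T + d + d * d + (a + j) * (k - 1 - (a + j)) + (2 * (k - a - 3) + 2 * j * (a - 2)) ≤ (m' + d) * k := by
  obtain ⟨u, rfl⟩ : ∃ u, a = d + j + 3 + u := ⟨a - (d + j + 3), by omega⟩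
  obtain ⟨c, rfl⟩ : ∃ c, k = 3 * (d + j + 3 + u) + j + c := ⟨k - (3 * (d + j + 3 + u) + j), by omega⟩
  have e1 : 3 * (d + j + 3 + u) + j + c - 1 - 1 - (d + j) = 2 * d + 3 * j + 7 + 3 * u + c := by omega
  have e2 : 3 * (d + j + 3 + u) + j + c - 1 - 2 * (d + j + 3 + u) - 1 = d + 2 * j + 1 + u + c := by omega
  have e3 : d + j + 3 + u - (d + j) = 3 + u := by omega
  have e4 : 3 * (d + j + 3 + u) + j + c - 1 = 3 * d + 4 * j + 8 + 3 * u + c := by omega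
  have e5 : 3 * (d + j + 3 + u) + j + c - (d + j + 3 + u) - 2 = 2 * d + 3 * j + 4 + 2 * u + c := by omega
  have e6 : 3 * (d + j + 3 + u) + j + c - 1 - (d + j + 3 + u + j) = 2 * d + 2 * j + 5 + 2 * u + c := by omega
  have e7 : 3 * (d + j + 3 + u) + j + c - (d + j + 3 + u) - 3 = 2 * d + 3 * j + 3 + 2 * u + c := by omega
  have e8 : d + j + 3 + u - 2 = d + j + 1 + u := by omega
  have e9 : 3 * (d + j + 3 + u) + j + c - (d + j + 3 + u) = 2 * d + 3 * j + 6 + 2 * u + c := by omega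
  rw [e1, e2, e3, e4] at hgap
  rw [e5] at hT
  rw [e6, e7, e8]
  rw [e9] at hmd
  linarith [hgap, hT, hmd, Nat.zero_le (u * u), Nat.zero_le (d * u), Nat.zero_le (c * u), Nat.zero_le (j * u)]

/-- `d + j + 2 = a`: `D − z` on the `T` cell `(k − 1, a, a − 2)`. -/
theorem rowJ_del_T (a j d k m' S' T : ℕ) (ha : j + 5 ≤ a) (hs : d + j + 2 = a) (hk : 3 * a + j ≤ k)
    (hmd : m' + d + (a + j) = a * (k - a))
    (hgap : S' + (a - 2) * (k - 1 - 1 - (a - 2)) + 2 * (k - 1 - 2 * a - 1) ≤ m' * (k - 1))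
    (hT : T ≤ d * (k - a - 2)) :
    S' + 2 * T + d + d * d + (a + j) * (k - 1 - (a + j)) + (2 * (k - a - 3) + 2 * j * (a - 2)) ≤ (m' + d) * k := by
  subst hs
  obtain ⟨c, rfl⟩ : ∃ c, k = 3 * (d + j + 2) + j + c := ⟨k - (3 * (d + j + 2) + j), by omega⟩
  have e0 : d + j + 2 - 2 = d + j := by omega
  have e1 : 3 * (d + j + 2) + j + c - 1 - 1 - (d + j) = 2 * d + 3 * j + 4 + c := by omega
  have e2 : 3 * (d + j + 2) + j + c - 1 - 2 * (d + j + 2) - 1 = d + 2 * j + c := by omega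
  have e4 : 3 * (d + j + 2) + j + c - 1 = 3 * d + 4 * j + 5 + c := by omega
  have e5 : 3 * (d + j + 2) + j + c - (d + j + 2) - 2 = 2 * d + 3 * j + 2 + c := by omega
  have e6 : 3 * (d + j + 2) + j + c - 1 - (d + j + 2 + j) = 2 * d + 2 * j + 3 + c := by omega
  have e7 : 3 * (d + j + 2) + j + c - (d + j + 2) - 3 = 2 * d + 3 * j + 1 + c := by omega
  have e9 : 3 * (d + j + 2) + j + c - (d + j + 2) = 2 * d + 3 * j + 4 + c := by omega
  rw [e0, e1, e2, e4] at hgap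
  rw [e5] at hT
  rw [e6, e7, e0]
  rw [e9] at hmd
  have hd3 : 3 ≤ d := by omega
  linarith [hgap, hT, hmd, hd3]

/-- `d + j + 1 = a`: `D − z` on the `B2` cell `(k − 1, a, a − 1)`: EXACT. -/
theorem rowJ_del_B (a j d k m' S' T : ℕ) (ha : j + 5 ≤ a) (hs : d + j + 1 = a) (hk : 3 * a + j ≤ k)
    (hmd : m' + d + (a + j) = a * (k - a))
    (hgap : S' + (a - 1) * (k - 1 - 1 - (a - 1)) + 2 * (k - 1 - 2 * a - 1) ≤ m' * (k - 1))
    (hT : T ≤ d * (k - a - 2)) :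
    S' + 2 * T + d + d * d + (a + j) * (k - 1 - (a + j)) + (2 * (k - a - 3) + 2 * j * (a - 2)) ≤ (m' + d) * k := by
  subst hs
  obtain ⟨d'', rfl⟩ : ∃ d'', d = d'' + 4 := ⟨d - 4, by omega⟩
  obtain ⟨c, rfl⟩ : ∃ c, k = 3 * (d'' + 4 + j + 1) + j + c := ⟨k - (3 * (d'' + 4 + j + 1) + j), by omega⟩
  have e0 : d'' + 4 + j + 1 - 1 = d'' + 4 + j := by omega
  have e1 : 3 * (d'' + 4 + j + 1) + j + c - 1 - 1 - (d'' + 4 + j) = 2 * d'' + 3 * j + 9 + c := by omega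
  have e2 : 3 * (d'' + 4 + j + 1) + j + c - 1 - 2 * (d'' + 4 + j + 1) - 1 = d'' + 2 * j + 3 + c := by omega
  have e4 : 3 * (d'' + 4 + j + 1) + j + c - 1 = 3 * d'' + 4 * j + 14 + c := by omega
  have e5 : 3 * (d'' + 4 + j + 1) + j + c - (d'' + 4 + j + 1) - 2 = 2 * d'' + 3 * j + 8 + c := by omega
  have e6 : 3 * (d'' + 4 + j + 1) + j + c - 1 - (d'' + 4 + j + 1 + j) = 2 * d'' + 2 * j + 9 + c := by omega
  have e7 : 3 * (d'' + 4 + j + 1) + j + c - (d'' + 4 + j + 1) - 3 = 2 * d'' + 3 * j + 7 + c := by omega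
  have e8 : d'' + 4 + j + 1 - 2 = d'' + 3 + j := by omega
  have e9 : 3 * (d'' + 4 + j + 1) + j + c - (d'' + 4 + j + 1) = 2 * d'' + 3 * j + 10 + c := by omega
  rw [e0, e1, e2, e4] at hgap
  rw [e5] at hT
  rw [e6, e7, e8]
  rw [e9] at hmd
  nlinarith [hgap, hT, hmd]

/-- `d + j = a + j′`, `j′ + 1 ≤ j`: `D − z` on the cell `(k − 1, a, a + j′)` at the `(j′ + 1)`-broom gap of the
smaller row: slack `2 (j − j′ − 1)(j′ + 1)`, EXACT at `j′ = j − 1`. -/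
theorem rowJ_del_up (a j d j' k m' S' T : ℕ) (ha : j + 5 ≤ a) (hs : d + j = a + j') (hj' : j' + 1 ≤ j)
    (hk : 3 * a + j ≤ k) (hmd : m' + d + (a + j) = a * (k - a))
    (hgap : S' + (a + j') * (k - 1 - 1 - (a + j')) + (2 * (k - 1 - a - 3) + 2 * j' * (a - 2)) ≤ m' * (k - 1))
    (hT : T ≤ d * (k - a - 2)) :
    S' + 2 * T + d + d * d + (a + j) * (k - 1 - (a + j)) + (2 * (k - a - 3) + 2 * j * (a - 2)) ≤ (m' + d) * k := by
  obtain ⟨i, rfl⟩ : ∃ i, j = j' + 1 + i := ⟨j - (j' + 1), by omega⟩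
  obtain ⟨w, rfl⟩ : ∃ w, a = j' + 1 + i + 5 + w := ⟨a - (j' + 1 + i + 5), by omega⟩
  have hd' : d = j' + 5 + w := by omega
  subst hd'
  obtain ⟨c, rfl⟩ : ∃ c, k = 3 * (j' + 1 + i + 5 + w) + (j' + 1 + i) + c :=
    ⟨k - (3 * (j' + 1 + i + 5 + w) + (j' + 1 + i)), by omega⟩
  have e1 : 3 * (j' + 1 + i + 5 + w) + (j' + 1 + i) + c - 1 - 1 - (j' + 1 + i + 5 + w + j') =
      2 * j' + 3 * i + 11 + 2 * w + c := by omega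
  have e2 : 3 * (j' + 1 + i + 5 + w) + (j' + 1 + i) + c - 1 - (j' + 1 + i + 5 + w) - 3 =
      3 * j' + 3 * i + 9 + 2 * w + c := by omega
  have e3 : j' + 1 + i + 5 + w - 2 = j' + i + 4 + w := by omega
  have e4 : 3 * (j' + 1 + i + 5 + w) + (j' + 1 + i) + c - 1 = 4 * j' + 4 * i + 18 + 3 * w + c := by omega
  have e5 : 3 * (j' + 1 + i + 5 + w) + (j' + 1 + i) + c - (j' + 1 + i + 5 + w) - 2 =
      3 * j' + 3 * i + 11 + 2 * w + c := by omega
  have e6 : 3 * (j' + 1 + i + 5 + w) + (j' + 1 + i) + c - 1 - (j' + 1 + i + 5 + w + (j' + 1 + i)) =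
      2 * j' + 2 * i + 11 + 2 * w + c := by omega
  have e7 : 3 * (j' + 1 + i + 5 + w) + (j' + 1 + i) + c - (j' + 1 + i + 5 + w) - 3 =
      3 * j' + 3 * i + 10 + 2 * w + c := by omega
  have e9 : 3 * (j' + 1 + i + 5 + w) + (j' + 1 + i) + c - (j' + 1 + i + 5 + w) =
      3 * j' + 3 * i + 13 + 2 * w + c := by omega
  rw [e1, e2, e3, e4] at hgap
  rw [e5] at hT
  rw [e6, e7, e3]
  rw [e9] at hmd
  linarith [hgap, hT, hmd, Nat.zero_le (i * j')]

/-- The crude mixed read at `d = 2` (`t = s₀ = 1`): `S′ ≤ closed (k − 1, a, 2 + j)`, the off-side neighbour at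
`≤ a`, the in-side one at `≤ k − a − 2`: slack `2`. -/
theorem rowJ_mixed_two (a j k m' S' T : ℕ) (ha : j + 5 ≤ a) (hk : 3 * a + j ≤ k)
    (hmd : m' + 2 + (a + j) = a * (k - a)) (hS' : S' + (2 + j) * (k - 1 - 1 - (2 + j)) ≤ m' * (k - 1))
    (hT : T ≤ (k - a - 2) + a) :
    S' + 2 * T + 2 + 2 * 2 + (a + j) * (k - 1 - (a + j)) + (2 * (k - a - 3) + 2 * j * (a - 2)) ≤ (m' + 2) * k := by
  obtain ⟨w, rfl⟩ : ∃ w, a = j + 5 + w := ⟨a - (j + 5), by omega⟩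
  obtain ⟨c, rfl⟩ : ∃ c, k = 3 * (j + 5 + w) + j + c := ⟨k - (3 * (j + 5 + w) + j), by omega⟩
  have e1 : 3 * (j + 5 + w) + j + c - 1 - 1 - (2 + j) = 3 * j + 11 + 3 * w + c := by omega
  have e4 : 3 * (j + 5 + w) + j + c - 1 = 4 * j + 14 + 3 * w + c := by omega
  have e5 : 3 * (j + 5 + w) + j + c - (j + 5 + w) - 2 = 3 * j + 8 + 2 * w + c := by omega
  have e6 : 3 * (j + 5 + w) + j + c - 1 - (j + 5 + w + j) = 2 * j + 9 + 2 * w + c := by omega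
  have e7 : 3 * (j + 5 + w) + j + c - (j + 5 + w) - 3 = 3 * j + 7 + 2 * w + c := by omega
  have e8 : j + 5 + w - 2 = j + 3 + w := by omega
  have e9 : 3 * (j + 5 + w) + j + c - (j + 5 + w) = 3 * j + 10 + 2 * w + c := by omega
  rw [e1, e4] at hS'
  rw [e5] at hT
  rw [e6, e7, e8]
  rw [e9] at hmd
  nlinarith [hS', hT, hmd]

end C047

end TriangleCap

end PercRepro
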